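import Mathlib

/-!
# Expander mixing from a Rayleigh bound on `𝟙^⊥` (matrix form)
# (crux `LevelGradedCohnUmans.GradedDesignFamily`, stmt-MatrixMultiplication-7610; negative side,
# line `quadratic-extension-level-one-cell`, stub `indicator_mulVec_le_of_rayleigh`)

Let `A` be a real symmetric `V × V` matrix with constant row sums `k` (`A 𝟙 = k 𝟙`) whose
quadratic form is bounded by `θ` on the vectors of coordinate sum zero
(`x ⬝ A x ≤ θ (x ⬝ x)` whenever `∑ v, x v = 0`).  Then for every `S ⊆ V`, writing `s := |S|`,
`n := |V|` and `1_S` for the indicator vector of `S`,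

* `indicator_mulVec_le_of_rayleigh` — `1_S ⬝ A 1_S ≤ k s² / n + θ (s - s² / n)`.

This is the expander mixing lemma in matrix form; applied to the adjacency matrix of the Grassmann
graph of lines of `PG(3,q)` (`k = q (q + 1)²`, `θ = q² - 1`) it bounds the number of meeting pairs
inside a line set `S`, the second half of the L1-row theorem of the line's negative programme.

Proof (pure algebra, no spectral theorem).  If `V` is empty then `S = ∅` and both sides vanish.
Otherwise put `c := s / n` and `x := 1_S - c • 𝟙`, so that `∑ v, x v = s - c n = 0` and
`1_S = x + c • 𝟙`.  Expanding the quadratic form bilinearly,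
`1_S ⬝ A 1_S = x ⬝ A x + c (x ⬝ A 𝟙) + c (𝟙 ⬝ A x) + c² (𝟙 ⬝ A 𝟙)`; here `x ⬝ A 𝟙 = k (x ⬝ 𝟙) = 0`,
`𝟙 ⬝ A x = x ⬝ Aᵀ 𝟙 = x ⬝ A 𝟙 = 0` by symmetry, and `𝟙 ⬝ A 𝟙 = k n`, so the left-hand side is
`x ⬝ A x + k s² / n ≤ θ (x ⬝ x) + k s² / n`, and finally `x ⬝ x = ∑ v, (1_S v - c)² = s - s² / n`.

Sorry-free; axioms `propext`, `Classical.choice`, `Quot.sound`.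
-/

set_option linter.dupNamespace false

open scoped BigOperators

namespace Summit.MatrixMultiplication.MatrixMultiplication.Theorems.GradedDesignFamily.Negative

/-- **Expander mixing lemma, matrix form.**  For a real symmetric matrix `A` with `A 𝟙 = k 𝟙` and
`x ⬝ A x ≤ θ (x ⬝ x)` on `𝟙^⊥`, the indicator vector `1_S` of any `S ⊆ V` satisfies
`1_S ⬝ A 1_S ≤ k |S|² / |V| + θ (|S| - |S|² / |V|)`. [folklore] -/
theorem indicator_mulVec_le_of_rayleigh :
    ∀ {V : Type} [Fintype V] [DecidableEq V] (A : Matrix V V ℝ), A.IsSymm → ∀ (k θ : ℝ),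
      (A.mulVec (fun _ => 1) = fun _ => k) →
      (∀ x : V → ℝ, ∑ v, x v = 0 → dotProduct x (A.mulVec x) ≤ θ * dotProduct x x) →
      ∀ S : Finset V,
        dotProduct (fun v => if v ∈ S then (1 : ℝ) else 0)
            (A.mulVec fun v => if v ∈ S then (1 : ℝ) else 0)
          ≤ k * (S.card : ℝ) ^ 2 / Fintype.card V +
            θ * ((S.card : ℝ) - (S.card : ℝ) ^ 2 / Fintype.card V) := by
  intro V _ _ A hA k θ hk hθ S
  rcases isEmpty_or_nonempty V with hV | hV
  · -- `V` empty: `S = ∅` and both sides vanish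
    obtain rfl : S = ∅ := S.eq_empty_of_isEmpty
    simp [dotProduct]
  -- `V` nonempty: `n ≠ 0`
  have hn : (Fintype.card V : ℝ) ≠ 0 := Nat.cast_ne_zero.2 Fintype.card_ne_zero
  set oneS : V → ℝ := fun v => if v ∈ S then (1 : ℝ) else 0 with honeS
  set c : ℝ := (S.card : ℝ) / Fintype.card V with hc
  set x : V → ℝ := oneS - c • fun _ => (1 : ℝ) with hx
  -- elementary sums
  have hsum1 : ∑ v, oneS v = S.card := by simp [honeS]
  have hsq : ∀ v, oneS v * oneS v = oneS v := fun v => by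
    by_cases hv : v ∈ S <;> simp [honeS, hv]
  have hsumx : ∑ v, x v = 0 := by
    simp only [hx, Pi.sub_apply, Pi.smul_apply, smul_eq_mul, mul_one, Finset.sum_sub_distrib,
      hsum1, Finset.sum_const, Finset.card_univ, nsmul_eq_mul, hc]
    field_simp
    ring
  -- `x ⬝ A 𝟙 = k (∑ x) = 0`
  have hxA1 : dotProduct x (A.mulVec fun _ => (1 : ℝ)) = 0 := by
    rw [hk]
    simp only [dotProduct, ← Finset.sum_mul, hsumx, zero_mul]
  -- `𝟙 ⬝ A x = x ⬝ Aᵀ 𝟙 = 0` by symmetry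
  have h1Ax : dotProduct (fun _ => (1 : ℝ)) (A.mulVec x) = 0 := by
    rw [← Matrix.dotProduct_transpose_mulVec A x, hA.eq, hxA1]
  -- `𝟙 ⬝ A 𝟙 = k n`
  have h1A1 :
      dotProduct (fun _ : V => (1 : ℝ)) (A.mulVec fun _ => (1 : ℝ)) = k * Fintype.card V := by
    rw [hk]
    simp [dotProduct, Finset.sum_const, Finset.card_univ, mul_comm]
  -- `x ⬝ x = s - s² / n`
  have hxx : dotProduct x x = S.card - (S.card : ℝ) ^ 2 / Fintype.card V := by
    have hpt : ∀ v, x v * x v = (1 - 2 * c) * oneS v + c * c := fun v => by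
      simp only [hx, Pi.sub_apply, Pi.smul_apply, smul_eq_mul, mul_one]
      linear_combination hsq v
    simp only [dotProduct, hpt, Finset.sum_add_distrib, ← Finset.mul_sum, hsum1, Finset.sum_const,
      Finset.card_univ, nsmul_eq_mul, hc]
    field_simp
    ring
  -- the decomposition `1_S = x + c • 𝟙` and the bilinear expansion
  have hdec : oneS = x + c • fun _ => (1 : ℝ) := by rw [hx, sub_add_cancel]
  have hexp : dotProduct oneS (A.mulVec oneS) =
      dotProduct x (A.mulVec x) + k * (S.card : ℝ) ^ 2 / Fintype.card V := by
    rw [hdec, Matrix.mulVec_add, Matrix.mulVec_smul, add_dotProduct, dotProduct_add, dotProduct_add,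
      smul_dotProduct, smul_dotProduct, dotProduct_smul, dotProduct_smul, hxA1, h1Ax, h1A1]
    simp only [smul_eq_mul, mul_zero, add_zero, zero_add, hc]
    field_simp
  -- conclude with the Rayleigh hypothesis
  calc dotProduct oneS (A.mulVec oneS)
      = dotProduct x (A.mulVec x) + k * (S.card : ℝ) ^ 2 / Fintype.card V := hexp
    _ ≤ θ * dotProduct x x + k * (S.card : ℝ) ^ 2 / Fintype.card V := by
        gcongr
        exact hθ x hsumx
    _ = k * (S.card : ℝ) ^ 2 / Fintype.card V +
          θ * ((S.card : ℝ) - (S.card : ℝ) ^ 2 / Fintype.card V) := by rw [hxx, add_comm]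

end Summit.MatrixMultiplication.MatrixMultiplication.Theorems.GradedDesignFamily.Negative
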